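import Literature.Analysis.OperatorTheory.ModularKMSSubspace
import Literature.Analysis.Complex.StripResidueFormula
import Mathlib.Analysis.Complex.LocallyUniformLimit
import HarnessLib

/-!
# The analytic operator family `z ↦ R^{1/2−z}(2−R)^{1/2+z}` of a standard real subspace
# (Rieffel–van Daele, Lemma 4.7)

Let `𝒦` be a standard real subspace of a complex Hilbert space, `R = P + Q`,
`T = R^{1/2}(2 − R)^{1/2}`, `Δ^{it} = (2 − R)^{it}R^{−it}` (`modU`). In the proof of their Lemma 4.7,
Rieffel–van Daele (*A bounded operator approach to Tomita–Takesaki theory*, Pacific J. Math. 69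
(1977)) consider, for a bounded operator `x` and vectors `ξ, η`, the function

> `f(z) = ⟨R^{−z+1/2}(2 − R)^{z+1/2} x R^{z+1/2}(2 − R)^{−z+1/2} ξ, η⟩`

"defined on the strip `|Re z| ≤ 1/2`. Then `f` satisfies the hypotheses of Lemma 4.6. Moreover
`λ f(it + 1/2) + λ̄ f(it − 1/2) = ⟨Δ^{it}(λ(2 − R)xR + λ̄ Rx(2 − R))Δ^{−it}ξ, η⟩` … Also
`f(0) = ⟨TxTξ, η⟩`. Thus if we apply Lemma 4.6 we obtain …" (p. 204).

We build this function (`stripFun`) with the bounded Borel functional calculus: the symbol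
`a_z(λ) = λ^{1/2−z}(2−λ)^{1/2+z} = λ e^{(z+1/2)L(λ)}`, `L = log(2 − λ) − log λ`, is the kernel
`k(iz + i/2, λ)` of `Literature.Analysis.OperatorTheory.ModularKernel` (`afun`), bounded by `2` on
the closed strip, and `A(z) = a_z(R)` (`modA`). We prove the hypotheses of Lemma 4.6:
* continuity (`continuous_stripFun`, by dominated convergence in the functional calculus) and
  boundedness (`norm_stripFun_le`);
* holomorphy on the open strip (`differentiableOn_stripFun`): `A(z)` is the uniform-on-the-strip
  strong limit of the entire operator families `A_ε(z) = a_z(R_ε)` with `R_ε = R` clamped to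
  `[ε, 2 − ε]` (`modAE`, `hasDerivAt_modAE`: operator-norm derivative from the Taylor bound
  `‖e^w − 1 − w‖ ≤ ‖w‖²`), using that the spectral measures of `R` give no mass to `{0, 2}`
  ("both `R` and `2 − R` are injective … the spectral measures for `R` and `2 − R` are both
  concentrated on the open interval `(0, 2)`", p. 194), and a locally uniform limit of
  holomorphic functions is holomorphic;
* the boundary values `f(1/2 + it) = ⟨η, Δ^{it}(2 − R) x R Δ^{−it} ξ⟩`,
  `f(−1/2 + it) = ⟨η, Δ^{it} R x (2 − R) Δ^{−it} ξ⟩` and `f(0) = ⟨η, T x T ξ⟩`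
  (Mathlib's inner product is conjugate-linear in the first variable, so R–vD's `⟨a, b⟩` is our
  `⟪b, a⟫`);
and deduce from Lemma 4.6 (`Literature.Analysis.Complex.RieffelVanDaele_strip_formula`) the
**integral identity** `inner_modT_apply_modT_eq_integral`:
`⟪η, T x T ξ⟫ = ∫ W_φ(t) (e^{iφ/2} ⟪η, Δ^{it}(2−R)xRΔ^{−it} ξ⟫ + e^{−iφ/2} ⟪η, Δ^{it}Rx(2−R)Δ^{−it} ξ⟫) dt`
for every bounded `x`, all `ξ, η` and `|φ| < π` — the analytic content of Lemma 4.7.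

## References
* M. A. Rieffel, A. van Daele, *A bounded operator approach to Tomita–Takesaki theory*, Pacific
  J. Math. 69 (1977) 187–221, Lemmas 4.6, 4.7. [RieffelVandaele1977]
* M. Reed, B. Simon, *Methods of Modern Mathematical Physics I*, Thm. VII.2. [ReedSimonI1980]
-/

noncomputable section

open Complex ContinuousLinearMap MeasureTheory Filter Set Asymptotics
open _root_.Topology
open scoped InnerProductSpace ComplexConjugate Real

set_option synthInstance.maxHeartbeats 200000

namespace Literature.Analysis.OperatorTheory

attribute [local instance] realIPS

variable {H : Type*} [NormedAddCommGroup H] [InnerProductSpace ℂ H] [CompleteSpace H]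

/-! ### The symbols -/

section Symbols

/-- The strip symbol `a_z(λ) = λ^{1/2−z}(2−λ)^{1/2+z} = k(iz + i/2, λ)` (clamped, `|a_z| ≤ 2`).
[cite: RieffelVandaele1977, Lemma 4.7 (proof)] -/
def afun (z : ℂ) (l : ℝ) : ℂ := kfun (I * z + I / 2) l

/-- `Im(iz + i/2) = Re z + 1/2`. [folklore] -/
theorem I_mul_add_half_im (z : ℂ) : (I * z + I / 2).im = z.re + 1 / 2 := by
  simp [Complex.add_im, Complex.mul_im]

/-- `Re(iz + i/2) = −Im z`. [folklore] -/
theorem I_mul_add_half_re (z : ℂ) : (I * z + I / 2).re = -z.im := by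
  simp [Complex.add_re, Complex.mul_re]

/-- `|a_z(λ)| ≤ 2`. [cite: RieffelVandaele1977, Lemma 4.7 (proof)] -/
theorem norm_afun_le (z : ℂ) (l : ℝ) : ‖afun z l‖ ≤ 2 := norm_kfun_le _ _

/-- `a_z` is Borel measurable in `λ`. [folklore] -/
theorem measurable_afun (z : ℂ) : Measurable (afun z) := measurable_kfun_right _

/-- `a_z(λ)` is continuous in `z`. [folklore] -/
theorem continuous_afun_left (l : ℝ) : Continuous fun z => afun z l :=
  (continuous_kfun_left l).comp (by fun_prop)

/-- On the closed strip `|Re z| ≤ 1/2`: `a_z(λ) = λ e^{(z + 1/2) L(λ)}`. [cite: RieffelVandaele1977, Lemma 4.7 (proof)] -/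
theorem afun_eq_of_abs_re_le {z : ℂ} (hz : |z.re| ≤ 1 / 2) (l : ℝ) :
    afun z l = (clamp02 l : ℂ) * Complex.exp ((z + 1 / 2) * modLog l) := by
  have hz' := abs_le.1 hz
  rw [afun, kfun_eq_khol (by rw [I_mul_add_half_im]; constructor <;> linarith), khol]
  congr 1
  congr 1
  ring_nf
  rw [I_sq]
  ring

/-- The `ε`-clamp of `λ` to `[ε, 2 − ε]`. [folklore] -/
def clampE (ε l : ℝ) : ℝ := max ε (min (2 - ε) l)

/-- `clampE ε λ ∈ [ε, 2 − ε]`. [folklore] -/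
theorem clampE_mem {ε : ℝ} (hε1 : ε ≤ 1) (l : ℝ) : clampE ε l ∈ Icc ε (2 - ε) :=
  ⟨le_max_left _ _, max_le (by linarith) (min_le_left _ _)⟩

/-- The clamp is the identity on `[ε, 2 − ε]`. [folklore] -/
theorem clampE_of_mem {ε l : ℝ} (hl : l ∈ Icc ε (2 - ε)) : clampE ε l = l := by
  rw [clampE, min_eq_right hl.2, max_eq_right hl.1]

/-- The clamp is continuous. [folklore] -/
theorem continuous_clampE (ε : ℝ) : Continuous (clampE ε) := by unfold clampE; fun_prop

/-- `clampE ε λ ∈ (0, 2)`. [folklore] -/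
theorem clampE_mem_Ioo {ε : ℝ} (hε : 0 < ε) (hε1 : ε ≤ 1) (l : ℝ) : clampE ε l ∈ Ioo (0 : ℝ) 2 :=
  ⟨hε.trans_le (clampE_mem hε1 l).1, by linarith [(clampE_mem hε1 l).2]⟩

/-- `clamp02 ∘ clampE ε = clampE ε`. [folklore] -/
theorem clamp02_clampE {ε : ℝ} (hε : 0 < ε) (hε1 : ε ≤ 1) (l : ℝ) : clamp02 (clampE ε l) = clampE ε l :=
  clamp02_of_mem ⟨(clampE_mem_Ioo hε hε1 l).1.le, (clampE_mem_Ioo hε hε1 l).2.le⟩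

/-- A bound for `|L|` on `[ε, 2 − ε]`. [folklore] -/
def logBound (ε : ℝ) : ℝ := 2 * (|Real.log ε| + Real.log 2)

/-- `0 ≤ logBound ε`. [folklore] -/
theorem logBound_nonneg (ε : ℝ) : 0 ≤ logBound ε := by
  unfold logBound; positivity

/-- `|log c| ≤ |log ε| + log 2` for `c ∈ [ε, 2]`. [folklore] -/
theorem abs_log_le_of_mem {ε c : ℝ} (hε : 0 < ε) (hc : c ∈ Icc ε 2) :
    |Real.log c| ≤ |Real.log ε| + Real.log 2 := by
  have h1 : Real.log ε ≤ Real.log c := Real.log_le_log hε hc.1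
  have h2 : Real.log c ≤ Real.log 2 := Real.log_le_log (hε.trans_le hc.1) hc.2
  have h3 : 0 < Real.log 2 := Real.log_pos one_lt_two
  rw [abs_le]
  constructor
  · linarith [neg_abs_le (Real.log ε)]
  · linarith [abs_nonneg (Real.log ε)]

/-- `|L(clampE ε λ)| ≤ logBound ε`. [folklore] -/
theorem abs_modLog_clampE_le {ε : ℝ} (hε : 0 < ε) (hε1 : ε ≤ 1) (l : ℝ) :
    |modLog (clampE ε l)| ≤ logBound ε := by
  have hc := clampE_mem hε1 l
  rw [modLog, clamp02_clampE hε hε1]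
  have h1 := abs_log_le_of_mem hε (c := clampE ε l) ⟨hc.1, by linarith [hc.2]⟩
  have h2 := abs_log_le_of_mem hε (c := 2 - clampE ε l) ⟨by linarith [hc.2], by linarith [hc.1]⟩
  calc |Real.log (2 - clampE ε l) - Real.log (clampE ε l)|
      ≤ |Real.log (2 - clampE ε l)| + |Real.log (clampE ε l)| := abs_sub _ _
    _ ≤ logBound ε := by unfold logBound; linarith

/-- The regularised (entire in `z`) symbol `a^ε_z(λ) = c e^{(z + 1/2)L(c)}`, `c = clampE ε λ`.
[cite: RieffelVandaele1977, Lemma 4.7 (proof)] -/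
def aholE (ε : ℝ) (z : ℂ) (l : ℝ) : ℂ :=
  (clampE ε l : ℂ) * Complex.exp ((z + 1 / 2) * modLog (clampE ε l))

/-- On the closed strip the regularised symbol is `a_z ∘ clampE ε`. [folklore] -/
theorem aholE_eq_afun {ε : ℝ} (hε : 0 < ε) (hε1 : ε ≤ 1) {z : ℂ} (hz : |z.re| ≤ 1 / 2) (l : ℝ) :
    aholE ε z l = afun z (clampE ε l) := by
  rw [afun_eq_of_abs_re_le hz, clamp02_clampE hε hε1, aholE]

/-- The regularised symbol is measurable in `λ`. [folklore] -/
theorem measurable_aholE (ε : ℝ) (z : ℂ) : Measurable (aholE ε z) := by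
  unfold aholE
  have h1 : Measurable fun l => modLog (clampE ε l) := measurable_modLog.comp (continuous_clampE ε).measurable
  have h2 : Measurable fun l => (clampE ε l : ℂ) := Complex.measurable_ofReal.comp (continuous_clampE ε).measurable
  exact h2.mul (Complex.measurable_exp.comp (measurable_const.mul (Complex.measurable_ofReal.comp h1)))

/-- `|a^ε_z(λ)| ≤ 2 e^{|Re z + 1/2| logBound ε}`. [folklore] -/
theorem norm_aholE_le {ε : ℝ} (hε : 0 < ε) (hε1 : ε ≤ 1) (z : ℂ) (l : ℝ) :
    ‖aholE ε z l‖ ≤ 2 * Real.exp (|z.re + 1 / 2| * logBound ε) := by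
  have hc := clampE_mem hε1 l
  rw [aholE, norm_mul, Complex.norm_real, Complex.norm_exp, Real.norm_eq_abs,
    abs_of_pos (hε.trans_le hc.1)]
  have hre : ((z + 1 / 2) * (modLog (clampE ε l) : ℂ)).re = (z.re + 1 / 2) * modLog (clampE ε l) := by
    simp [Complex.mul_re]
  rw [hre]
  have h1 : clampE ε l ≤ 2 := by linarith [hc.2]
  have h2 : Real.exp ((z.re + 1 / 2) * modLog (clampE ε l)) ≤ Real.exp (|z.re + 1 / 2| * logBound ε) := by
    rw [Real.exp_le_exp]
    calc (z.re + 1 / 2) * modLog (clampE ε l) ≤ |(z.re + 1 / 2) * modLog (clampE ε l)| := le_abs_self _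
      _ = |z.re + 1 / 2| * |modLog (clampE ε l)| := abs_mul _ _
      _ ≤ |z.re + 1 / 2| * logBound ε :=
          mul_le_mul_of_nonneg_left (abs_modLog_clampE_le hε hε1 l) (abs_nonneg _)
  exact mul_le_mul h1 h2 (Real.exp_pos _).le zero_le_two

/-- On the closed strip, `|a^ε_z(λ)| ≤ 2`. [folklore] -/
theorem norm_aholE_le_two {ε : ℝ} (hε : 0 < ε) (hε1 : ε ≤ 1) {z : ℂ} (hz : |z.re| ≤ 1 / 2) (l : ℝ) :
    ‖aholE ε z l‖ ≤ 2 := by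
  rw [aholE_eq_afun hε hε1 hz]
  exact norm_afun_le _ _

/-- The Taylor remainder of the regularised symbol. [folklore] -/
theorem aholE_add_sub_sub (ε : ℝ) (z h : ℂ) (l : ℝ) :
    aholE ε (z + h) l - aholE ε z l - h * (modLog (clampE ε l) * aholE ε z l) =
      aholE ε z l * (Complex.exp (h * modLog (clampE ε l)) - 1 - h * modLog (clampE ε l)) := by
  simp only [aholE]
  rw [show (z + h + 1 / 2) * (modLog (clampE ε l) : ℂ) =
      (z + 1 / 2) * modLog (clampE ε l) + h * modLog (clampE ε l) by ring, Complex.exp_add]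
  ring

/-- **Uniform quadratic Taylor bound** `|a^ε_{z+h} − a^ε_z − h L a^ε_z| ≤ 2e^{|Re z+1/2|B} B² |h|²`
for `|h| B ≤ 1`, `B = logBound ε`. [folklore] -/
theorem norm_aholE_taylor_le {ε : ℝ} (hε : 0 < ε) (hε1 : ε ≤ 1) (z h : ℂ)
    (hh : ‖h‖ * logBound ε ≤ 1) (l : ℝ) :
    ‖aholE ε (z + h) l - aholE ε z l - h * (modLog (clampE ε l) * aholE ε z l)‖ ≤
      2 * Real.exp (|z.re + 1 / 2| * logBound ε) * logBound ε ^ 2 * ‖h‖ ^ 2 := by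
  rw [aholE_add_sub_sub, norm_mul]
  have hx : ‖(h * modLog (clampE ε l) : ℂ)‖ ≤ ‖h‖ * logBound ε := by
    rw [norm_mul, Complex.norm_real, Real.norm_eq_abs]
    exact mul_le_mul_of_nonneg_left (abs_modLog_clampE_le hε hε1 l) (norm_nonneg _)
  have hrem := Complex.norm_exp_sub_one_sub_id_le (hx.trans hh)
  calc ‖aholE ε z l‖ * ‖Complex.exp (h * modLog (clampE ε l)) - 1 - h * modLog (clampE ε l)‖
      ≤ (2 * Real.exp (|z.re + 1 / 2| * logBound ε)) * (‖h‖ * logBound ε) ^ 2 :=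
        mul_le_mul (norm_aholE_le hε hε1 z l) (hrem.trans (by gcongr)) (norm_nonneg _) (by positivity)
    _ = 2 * Real.exp (|z.re + 1 / 2| * logBound ε) * logBound ε ^ 2 * ‖h‖ ^ 2 := by ring

/-- Off `[ε, 2 − ε]` nothing, on it the regularisation is exact:
`|a^ε_z(λ) − a_z(λ)|² ≤ 16 · 𝟙_{[ε,2−ε]ᶜ}(λ)` on the closed strip. [folklore] -/
theorem norm_aholE_sub_afun_sq_le {ε : ℝ} (hε : 0 < ε) (hε1 : ε ≤ 1) {z : ℂ} (hz : |z.re| ≤ 1 / 2)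
    (l : ℝ) : ‖aholE ε z l - afun z l‖ ^ 2 ≤ (Icc ε (2 - ε))ᶜ.indicator (fun _ => (4 : ℝ) ^ 2) l := by
  by_cases hl : l ∈ Icc ε (2 - ε)
  · rw [aholE_eq_afun hε hε1 hz, clampE_of_mem hl, sub_self, norm_zero, indicator_of_notMem (by simpa using hl)]
    norm_num
  · rw [indicator_of_mem (by simpa using hl)]
    have : ‖aholE ε z l - afun z l‖ ≤ 4 :=
      (norm_sub_le _ _).trans (by linarith [norm_aholE_le_two hε hε1 hz l, norm_afun_le z l])
    exact pow_le_pow_left₀ (norm_nonneg _) this 2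

end Symbols

/-! ### A norm estimate in the Borel functional calculus -/

section BorelEstimate

variable {A : H →L[ℂ] H} (hA : IsSelfAdjoint A)

include hA in
/-- If `|d|² ≤ c² 𝟙_s` pointwise then `‖d(A)ψ‖ ≤ c · μ_ψ(s)^{1/2}`. [cite: ReedSimonI1980, Thm. VII.2] -/
theorem norm_borelCFC_apply_le_of_sq_le_indicator {d : ℝ → ℂ} (hd : Measurable d) {C : ℝ}
    (hC : ∀ l, ‖d l‖ ≤ C) {s : Set ℝ} (hs : MeasurableSet s) {c : ℝ} (hc : 0 ≤ c)
    (h : ∀ l, ‖d l‖ ^ 2 ≤ s.indicator (fun _ => c ^ 2) l) (ψ : H) :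
    ‖borelCFC A hA d ψ‖ ≤ c * Real.sqrt ((specMeasure A hA ψ).real s) := by
  have hsq : ‖borelCFC A hA d ψ‖ ^ 2 ≤ c ^ 2 * (specMeasure A hA ψ).real s := by
    rw [norm_borelCFC_apply_sq hA hd hC ψ]
    calc ∫ l, ‖d l‖ ^ 2 ∂(specMeasure A hA ψ) ≤ ∫ l, s.indicator (fun _ => c ^ 2) l ∂(specMeasure A hA ψ) := by
          refine integral_mono_of_nonneg (Eventually.of_forall fun l => by positivity) ?_
            (Eventually.of_forall h)
          exact (integrable_const (c ^ 2)).indicator hs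
      _ = c ^ 2 * (specMeasure A hA ψ).real s := by
          rw [integral_indicator_const _ hs, smul_eq_mul, mul_comm]
  have h2 := Real.sqrt_le_sqrt hsq
  rwa [Real.sqrt_sq (norm_nonneg _), Real.sqrt_mul (sq_nonneg _), Real.sqrt_sq hc] at h2

end BorelEstimate

/-! ### The operator families -/

section Family

variable (K : Submodule ℝ H) [K.HasOrthogonalProjection]

/-- **`A(z) = a_z(R) = R^{1/2−z}(2−R)^{1/2+z}`** (bounded Borel calculus; `‖A(z)‖ ≤ 2`).
[cite: RieffelVandaele1977, Lemma 4.7 (proof)] -/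
def modA (z : ℂ) : H →L[ℂ] H := borelCFC (modR K) (modR_isSelfAdjoint K) (afun z)

/-- The regularised family `A_ε(z) = a^ε_z(R)`. [cite: RieffelVandaele1977, Lemma 4.7 (proof)] -/
def modAE (ε : ℝ) (z : ℂ) : H →L[ℂ] H := borelCFC (modR K) (modR_isSelfAdjoint K) (aholE ε z)

/-- `‖A(z)‖ ≤ 2`. [cite: RieffelVandaele1977, Lemma 4.7 (proof)] -/
theorem norm_modA_le (z : ℂ) : ‖modA K z‖ ≤ 2 :=
  norm_borelCFC_le _ (measurable_afun z) (norm_afun_le z)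

/-- `‖A_ε(z)‖ ≤ 2` on the closed strip. [folklore] -/
theorem norm_modAE_le {ε : ℝ} (hε : 0 < ε) (hε1 : ε ≤ 1) {z : ℂ} (hz : |z.re| ≤ 1 / 2) :
    ‖modAE K ε z‖ ≤ 2 :=
  norm_borelCFC_le _ (measurable_aholE ε z) (norm_aholE_le_two hε hε1 hz)

/-- **The regularised family is entire** (operator-norm derivative `(L a^ε_z)(R)`).
[cite: RieffelVandaele1977, Lemma 4.7 (proof)] -/
theorem hasDerivAt_modAE {ε : ℝ} (hε : 0 < ε) (hε1 : ε ≤ 1) (z : ℂ) :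
    HasDerivAt (fun w => modAE K ε w)
      (borelCFC (modR K) (modR_isSelfAdjoint K) (fun l => modLog (clampE ε l) * aholE ε z l)) z := by
  have hR := modR_isSelfAdjoint K
  set B := logBound ε with hB
  have hB0 : 0 ≤ B := logBound_nonneg ε
  -- measurability and bounds of the symbols involved
  have hmeas : ∀ w, Measurable (aholE ε w) := measurable_aholE ε
  have hbd : ∀ w, ∀ l, ‖aholE ε w l‖ ≤ 2 * Real.exp (|w.re + 1 / 2| * B) := fun w => norm_aholE_le hε hε1 w
  have hLm : Measurable fun l => (modLog (clampE ε l) : ℂ) :=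
    Complex.measurable_ofReal.comp (measurable_modLog.comp (continuous_clampE ε).measurable)
  have hdm : Measurable fun l => (modLog (clampE ε l) : ℂ) * aholE ε z l := hLm.mul (hmeas z)
  have hdb : ∀ l, ‖(modLog (clampE ε l) : ℂ) * aholE ε z l‖ ≤ B * (2 * Real.exp (|z.re + 1 / 2| * B)) :=
    fun l => by
      rw [norm_mul, Complex.norm_real, Real.norm_eq_abs]
      exact mul_le_mul (abs_modLog_clampE_le hε hε1 l) (hbd z l) (norm_nonneg _) hB0
  -- the quadratic remainder bound
  have key : ∀ h : ℂ, ‖h‖ * B ≤ 1 →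
      ‖modAE K ε (z + h) - modAE K ε z - h • borelCFC (modR K) hR
          (fun l => (modLog (clampE ε l) : ℂ) * aholE ε z l)‖ ≤
        2 * Real.exp (|z.re + 1 / 2| * B) * B ^ 2 * ‖h‖ ^ 2 := by
    intro h hh
    have hhm : Measurable fun l => h * ((modLog (clampE ε l) : ℂ) * aholE ε z l) := measurable_const.mul hdm
    have hhb : ∀ l, ‖h * ((modLog (clampE ε l) : ℂ) * aholE ε z l)‖ ≤ ‖h‖ * (B * (2 * Real.exp (|z.re + 1 / 2| * B))) :=
      fun l => by rw [norm_mul]; exact mul_le_mul_of_nonneg_left (hdb l) (norm_nonneg _)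
    rw [modAE, modAE, borelCFC_sub hR (hmeas (z + h)) (hmeas z) (hbd (z + h)) (hbd z),
      ← borelCFC_const_mul hR h hdm hdb,
      borelCFC_sub hR ((hmeas (z + h)).sub (hmeas z)) hhm
        (fun l => (norm_sub_le _ _).trans (add_le_add (hbd (z + h) l) (hbd z l))) hhb]
    refine norm_borelCFC_le hR (((hmeas (z + h)).sub (hmeas z)).sub hhm) fun l => ?_
    simp only [Pi.sub_apply]
    exact norm_aholE_taylor_le hε hε1 z h hh l
  rw [hasDerivAt_iff_isLittleO_nhds_zero, Asymptotics.isLittleO_iff]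
  intro c hc
  set Cz := 2 * Real.exp (|z.re + 1 / 2| * B) * B ^ 2 with hCz
  have hCz0 : 0 ≤ Cz := by positivity
  have hr : 0 < min (1 / (B + 1)) (c / (Cz + 1)) := lt_min (by positivity) (by positivity)
  filter_upwards [Metric.ball_mem_nhds (0 : ℂ) hr] with h hh
  rw [Metric.mem_ball, dist_zero_right, lt_min_iff] at hh
  have hhB : ‖h‖ * B ≤ 1 := by
    have h1 : ‖h‖ * B ≤ ‖h‖ * (B + 1) := by gcongr; linarith
    have h2 : ‖h‖ * (B + 1) ≤ 1 / (B + 1) * (B + 1) :=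
      mul_le_mul_of_nonneg_right hh.1.le (by positivity)
    rw [div_mul_cancel₀ _ (by positivity)] at h2
    exact h1.trans h2
  refine (key h hhB).trans ?_
  calc Cz * ‖h‖ ^ 2 = (Cz * ‖h‖) * ‖h‖ := by ring
    _ ≤ ((Cz + 1) * (c / (Cz + 1))) * ‖h‖ := by
        refine mul_le_mul_of_nonneg_right ?_ (norm_nonneg _)
        exact mul_le_mul (by linarith) hh.2.le (norm_nonneg _) (by positivity)
    _ = c * ‖h‖ := by rw [mul_div_cancel₀ _ (by positivity)]

/-- The regularised family is differentiable on `ℂ`. [folklore] -/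
theorem differentiable_modAE {ε : ℝ} (hε : 0 < ε) (hε1 : ε ≤ 1) :
    Differentiable ℂ fun w => modAE K ε w := fun z => (hasDerivAt_modAE K hε hε1 z).differentiableAt

/-- **R–vD's strip function** `f(z) = ⟪η, A(z) x A(−z) ξ⟫` (their `⟨A(z)xA(−z)ξ, η⟩`).
[cite: RieffelVandaele1977, Lemma 4.7 (proof)] -/
def stripFun (x : H →L[ℂ] H) (ξ η : H) (z : ℂ) : ℂ := ⟪η, modA K z (x (modA K (-z) ξ))⟫_ℂ

/-- The regularised strip functions `f_ε(z) = ⟪η, A_ε(z) x A_ε(−z) ξ⟫`. [folklore] -/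
def stripFunE (ε : ℝ) (x : H →L[ℂ] H) (ξ η : H) (z : ℂ) : ℂ := ⟪η, modAE K ε z (x (modAE K ε (-z) ξ))⟫_ℂ

/-- Each `f_ε` is entire. [folklore] -/
theorem differentiable_stripFunE {ε : ℝ} (hε : 0 < ε) (hε1 : ε ≤ 1) (x : H →L[ℂ] H) (ξ η : H) :
    Differentiable ℂ (stripFunE K ε x ξ η) := by
  have hA := differentiable_modAE K hε hε1
  have h1 : Differentiable ℂ fun z => modAE K ε (-z) ξ :=
    (hA.comp differentiable_neg).clm_apply (differentiable_const ξ)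
  have h2 : Differentiable ℂ fun z => x (modAE K ε (-z) ξ) := x.differentiable.comp h1
  have h3 : Differentiable ℂ fun z => modAE K ε z (x (modAE K ε (-z) ξ)) := hA.clm_apply h2
  exact (innerSL ℂ η).differentiable.comp h3

/-- `|f(z)| ≤ 4 ‖η‖ ‖x‖ ‖ξ‖`. [cite: RieffelVandaele1977, Lemma 4.7 (proof)] -/
theorem norm_stripFun_le (x : H →L[ℂ] H) (ξ η : H) (z : ℂ) :
    ‖stripFun K x ξ η z‖ ≤ ‖η‖ * (2 * (‖x‖ * (2 * ‖ξ‖))) := by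
  unfold stripFun
  refine (norm_inner_le_norm _ _).trans (mul_le_mul_of_nonneg_left ?_ (norm_nonneg _))
  calc ‖modA K z (x (modA K (-z) ξ))‖ ≤ ‖modA K z‖ * ‖x (modA K (-z) ξ)‖ := le_opNorm _ _
    _ ≤ 2 * (‖x‖ * (2 * ‖ξ‖)) := by
        refine mul_le_mul (norm_modA_le K z) ?_ (norm_nonneg _) zero_le_two
        calc ‖x (modA K (-z) ξ)‖ ≤ ‖x‖ * ‖modA K (-z) ξ‖ := le_opNorm _ _
          _ ≤ ‖x‖ * (2 * ‖ξ‖) := by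
              refine mul_le_mul_of_nonneg_left ?_ (norm_nonneg _)
              exact (le_opNorm _ _).trans (mul_le_mul_of_nonneg_right (norm_modA_le K (-z)) (norm_nonneg _))

/-- Strong continuity of `z ↦ A(z)ψ` (dominated convergence). [cite: RieffelVandaele1977, Lemma 4.7 (proof)] -/
theorem continuous_modA_apply (ψ : H) : Continuous fun z => modA K z ψ := by
  rw [continuous_iff_seqContinuous]
  intro u z hu
  exact tendsto_borelCFC_apply_of_tendsto (modR_isSelfAdjoint K) (fun n => measurable_afun (u n))
    (measurable_afun z) (fun n l => norm_afun_le _ _) (norm_afun_le z)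
    (fun l => ((continuous_afun_left l).tendsto z).comp hu) ψ

omit [CompleteSpace H] in
/-- A strongly continuous, norm-bounded operator family applied to a continuous vector family is
continuous. [folklore] -/
theorem continuous_apply_of_strongly_continuous {X : Type*} [TopologicalSpace X]
    {T : X → H →L[ℂ] H} {C : ℝ}
    (hT : ∀ ψ, Continuous fun z => T z ψ) (hC : ∀ z, ‖T z‖ ≤ C) {v : X → H} (hv : Continuous v) :
    Continuous fun z => T z (v z) := by
  refine continuous_iff_continuousAt.2 fun z₀ => ?_
  have h1 : Tendsto (fun z => T z (v z - v z₀)) (𝓝 z₀) (𝓝 0) := by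
    rw [tendsto_zero_iff_norm_tendsto_zero]
    have hb : ∀ z, ‖T z (v z - v z₀)‖ ≤ |C| * ‖v z - v z₀‖ := fun z =>
      (le_opNorm _ _).trans (mul_le_mul_of_nonneg_right ((hC z).trans (le_abs_self C)) (norm_nonneg _))
    refine squeeze_zero (fun _ => norm_nonneg _) hb ?_
    have : Tendsto (fun z => v z - v z₀) (𝓝 z₀) (𝓝 0) := by
      simpa using (hv.tendsto z₀).sub_const (v z₀)
    simpa using this.norm.const_mul |C|
  have h2 : Tendsto (fun z => T z (v z₀)) (𝓝 z₀) (𝓝 (T z₀ (v z₀))) := (hT (v z₀)).tendsto z₀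
  have h := h1.add h2
  simp only [map_sub, sub_add_cancel, zero_add] at h
  exact h

/-- **`f` is continuous** (on `ℂ`). [cite: RieffelVandaele1977, Lemma 4.7 (proof)] -/
theorem continuous_stripFun (x : H →L[ℂ] H) (ξ η : H) : Continuous (stripFun K x ξ η) := by
  unfold stripFun
  have h1 : Continuous fun z => modA K (-z) ξ := (continuous_modA_apply K ξ).comp continuous_neg
  have h2 : Continuous fun z => x (modA K (-z) ξ) := x.continuous.comp h1
  have h3 : Continuous fun z => modA K z (x (modA K (-z) ξ)) :=
    continuous_apply_of_strongly_continuous (continuous_modA_apply K) (norm_modA_le K) h2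
  exact continuous_const.inner h3

variable (hsep : ∀ x, x ∈ K → x ∈ mulI K → x = 0)
variable (hdense : Dense ((K ⊔ mulI K : Submodule ℝ H) : Set H))

/-- The "defect" `δ_ε(ψ) = 4 μ_ψ([ε, 2−ε]ᶜ)^{1/2}` controlling the regularisation. [folklore] -/
def regDefect (ε : ℝ) (ψ : H) : ℝ :=
  4 * Real.sqrt ((specMeasure (modR K) (modR_isSelfAdjoint K) ψ).real (Icc ε (2 - ε))ᶜ)

/-- `0 ≤ δ_ε(ψ)`. [folklore] -/
theorem regDefect_nonneg (ε : ℝ) (ψ : H) : 0 ≤ regDefect K ε ψ := by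
  unfold regDefect; positivity

/-- `‖(A_ε(z) − A(z))ψ‖ ≤ δ_ε(ψ)` on the closed strip. [cite: RieffelVandaele1977, Lemma 4.7 (proof)] -/
theorem norm_modAE_sub_modA_apply_le {ε : ℝ} (hε : 0 < ε) (hε1 : ε ≤ 1) {z : ℂ} (hz : |z.re| ≤ 1 / 2)
    (ψ : H) : ‖(modAE K ε z - modA K z) ψ‖ ≤ regDefect K ε ψ := by
  have hR := modR_isSelfAdjoint K
  rw [modAE, modA, borelCFC_sub hR (measurable_aholE ε z) (measurable_afun z) (norm_aholE_le_two hε hε1 hz)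
    (norm_afun_le z)]
  exact norm_borelCFC_apply_le_of_sq_le_indicator hR ((measurable_aholE ε z).sub (measurable_afun z))
    (C := 2 + 2) (fun l => (norm_sub_le _ _).trans (add_le_add (norm_aholE_le_two hε hε1 hz l) (norm_afun_le z l)))
    (measurableSet_Icc.compl) (by norm_num) (fun l => norm_aholE_sub_afun_sq_le hε hε1 hz l) ψ

/-- `‖(A_ε(z) − A(z))† ψ‖ ≤ δ_ε(ψ)` on the closed strip. [folklore] -/
theorem norm_adjoint_modAE_sub_modA_apply_le {ε : ℝ} (hε : 0 < ε) (hε1 : ε ≤ 1) {z : ℂ}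
    (hz : |z.re| ≤ 1 / 2) (ψ : H) :
    ‖ContinuousLinearMap.adjoint (modAE K ε z - modA K z) ψ‖ ≤ regDefect K ε ψ := by
  have hR := modR_isSelfAdjoint K
  have hm := (measurable_aholE ε z).sub (measurable_afun z)
  have hb : ∀ l, ‖(aholE ε z - afun z) l‖ ≤ 2 + 2 := fun l =>
    (norm_sub_le _ _).trans (add_le_add (norm_aholE_le_two hε hε1 hz l) (norm_afun_le z l))
  rw [modAE, modA, borelCFC_sub hR (measurable_aholE ε z) (measurable_afun z) (norm_aholE_le_two hε hε1 hz)
    (norm_afun_le z), adjoint_borelCFC hR hm hb]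
  refine norm_borelCFC_apply_le_of_sq_le_indicator hR (measurable_star_fun hm) (C := 2 + 2)
    (fun l => by rw [Pi.star_apply, norm_star]; exact hb l) (measurableSet_Icc.compl) (by norm_num)
    (fun l => ?_) ψ
  rw [Pi.star_apply, norm_star]
  exact norm_aholE_sub_afun_sq_le hε hε1 hz l

/-- **Uniform approximation on the closed strip**:
`|f_ε(z) − f(z)| ≤ 2‖x‖(‖ξ‖ δ_ε(η) + ‖η‖ δ_ε(ξ))`. [cite: RieffelVandaele1977, Lemma 4.7 (proof)] -/
theorem norm_stripFunE_sub_stripFun_le {ε : ℝ} (hε : 0 < ε) (hε1 : ε ≤ 1) (x : H →L[ℂ] H) (ξ η : H)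
    {z : ℂ} (hz : |z.re| ≤ 1 / 2) :
    ‖stripFunE K ε x ξ η z - stripFun K x ξ η z‖ ≤
      2 * ‖x‖ * (‖ξ‖ * regDefect K ε η + ‖η‖ * regDefect K ε ξ) := by
  have hz' : |(-z).re| ≤ 1 / 2 := by rwa [neg_re, abs_neg]
  unfold stripFunE stripFun
  rw [← inner_sub_right]
  -- split the difference
  have hsplit : modAE K ε z (x (modAE K ε (-z) ξ)) - modA K z (x (modA K (-z) ξ)) =
      (modAE K ε z - modA K z) (x (modAE K ε (-z) ξ)) + modA K z (x ((modAE K ε (-z) - modA K (-z)) ξ)) := by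
    simp only [sub_apply, map_sub]
    abel
  rw [hsplit, inner_add_right]
  refine (norm_add_le _ _).trans ?_
  have h1 : ‖⟪η, (modAE K ε z - modA K z) (x (modAE K ε (-z) ξ))⟫_ℂ‖ ≤ regDefect K ε η * (‖x‖ * (2 * ‖ξ‖)) := by
    rw [← adjoint_inner_left]
    refine (norm_inner_le_norm _ _).trans (mul_le_mul (norm_adjoint_modAE_sub_modA_apply_le K hε hε1 hz η)
      ?_ (norm_nonneg _) (regDefect_nonneg K ε η))
    exact (le_opNorm _ _).trans (mul_le_mul_of_nonneg_left ((le_opNorm _ _).trans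
      (mul_le_mul_of_nonneg_right (norm_modAE_le K hε hε1 hz') (norm_nonneg _))) (norm_nonneg _))
  have h2 : ‖⟪η, modA K z (x ((modAE K ε (-z) - modA K (-z)) ξ))⟫_ℂ‖ ≤ ‖η‖ * (2 * (‖x‖ * regDefect K ε ξ)) := by
    refine (norm_inner_le_norm _ _).trans (mul_le_mul_of_nonneg_left ?_ (norm_nonneg _))
    refine (le_opNorm _ _).trans (mul_le_mul (norm_modA_le K z) ?_ (norm_nonneg _) zero_le_two)
    exact (le_opNorm _ _).trans (mul_le_mul_of_nonneg_left (norm_modAE_sub_modA_apply_le K hε hε1 hz' ξ) (norm_nonneg _))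
  calc _ ≤ regDefect K ε η * (‖x‖ * (2 * ‖ξ‖)) + ‖η‖ * (2 * (‖x‖ * regDefect K ε ξ)) := add_le_add h1 h2
    _ = 2 * ‖x‖ * (‖ξ‖ * regDefect K ε η + ‖η‖ * regDefect K ε ξ) := by ring

/-- The regularisation parameters `ε_n = 1/(n+2) ∈ (0, 1/2]`. [folklore] -/
def epsSeq (n : ℕ) : ℝ := 1 / ((n : ℝ) + 2)

/-- `0 < ε_n`. [folklore] -/
theorem epsSeq_pos (n : ℕ) : 0 < epsSeq n := by unfold epsSeq; positivity

/-- `ε_n ≤ 1`. [folklore] -/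
theorem epsSeq_le_one (n : ℕ) : epsSeq n ≤ 1 := by
  unfold epsSeq
  rw [div_le_one (by positivity)]
  linarith [n.cast_nonneg (α := ℝ)]

/-- `ε_n → 0`. [folklore] -/
theorem tendsto_epsSeq : Tendsto epsSeq atTop (𝓝 0) := by
  unfold epsSeq
  have h := tendsto_one_div_add_atTop_nhds_zero_nat (𝕜 := ℝ)
  have h2 : Tendsto (fun n : ℕ => 1 / ((n : ℝ) + 1)) atTop (𝓝 0) := h
  have h3 := h2.comp (tendsto_add_atTop_nat 1)
  refine h3.congr fun n => ?_
  simp only [Function.comp_apply, Nat.cast_add, Nat.cast_one]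
  ring

include hsep hdense in
/-- **The defect tends to zero**: `μ_ψ([ε_n, 2 − ε_n]ᶜ) → μ_ψ((0,2)ᶜ) = 0` since `0, 2` are not
eigenvalues of `R`. [cite: RieffelVandaele1977, §3 (p. 194)] -/
theorem tendsto_regDefect (ψ : H) : Tendsto (fun n => regDefect K (epsSeq n) ψ) atTop (𝓝 0) := by
  set μ := specMeasure (modR K) (modR_isSelfAdjoint K) ψ with hμ
  have hanti : Antitone fun n => (Icc (epsSeq n) (2 - epsSeq n))ᶜ := by
    intro m n hmn
    apply compl_subset_compl.2
    have hε : epsSeq n ≤ epsSeq m := by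
      unfold epsSeq
      exact one_div_le_one_div_of_le (by positivity) (by exact_mod_cast Nat.add_le_add_right hmn 2)
    exact Icc_subset_Icc hε (by linarith)
  have hlim := tendsto_measure_iInter_atTop (μ := μ) (fun n => (measurableSet_Icc.compl).nullMeasurableSet)
    hanti ⟨0, measure_ne_top μ _⟩
  have hzero : μ (⋂ n, (Icc (epsSeq n) (2 - epsSeq n))ᶜ) = 0 := by
    refine measure_mono_null (fun l hl => ?_) (ae_iff.1 (ae_mem_Ioo K hsep hdense ψ))
    simp only [mem_iInter, mem_compl_iff, mem_Icc, not_and_or, not_le] at hl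
    simp only [mem_setOf_eq, mem_Ioo, not_and_or, not_lt]
    by_contra hcon
    push Not at hcon
    obtain ⟨h0, h2⟩ := hcon
    -- choose `n` with `ε_n < min l (2 - l)`
    have hpos : 0 < min l (2 - l) := lt_min h0 (by linarith)
    obtain ⟨n, hn⟩ := (tendsto_order.1 tendsto_epsSeq).2 _ hpos |>.exists
    rcases hl n with h | h
    · linarith [min_le_left l (2 - l)]
    · linarith [min_le_right l (2 - l)]
  rw [hzero] at hlim
  have hreal : Tendsto (fun n => μ.real (Icc (epsSeq n) (2 - epsSeq n))ᶜ) atTop (𝓝 0) := by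
    have := (ENNReal.tendsto_toReal ENNReal.zero_ne_top).comp hlim
    simpa [Function.comp_def, measureReal_def] using this
  have h4 : Tendsto (fun n => 4 * Real.sqrt (μ.real (Icc (epsSeq n) (2 - epsSeq n))ᶜ)) atTop (𝓝 (4 * Real.sqrt 0)) :=
    (Real.continuous_sqrt.tendsto 0 |>.comp hreal).const_mul 4
  simpa [regDefect] using h4

include hsep hdense in
/-- **`f_{ε_n} → f` uniformly on the closed strip.** [cite: RieffelVandaele1977, Lemma 4.7 (proof)] -/
theorem tendstoUniformlyOn_stripFunE (x : H →L[ℂ] H) (ξ η : H) :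
    TendstoUniformlyOn (fun n => stripFunE K (epsSeq n) x ξ η) (stripFun K x ξ η) atTop
      Literature.Analysis.Complex.closedStrip := by
  rw [Metric.tendstoUniformlyOn_iff]
  intro e he
  have hb : Tendsto (fun n => 2 * ‖x‖ * (‖ξ‖ * regDefect K (epsSeq n) η + ‖η‖ * regDefect K (epsSeq n) ξ))
      atTop (𝓝 0) := by
    have h := ((tendsto_regDefect K hsep hdense η).const_mul ‖ξ‖).add
      ((tendsto_regDefect K hsep hdense ξ).const_mul ‖η‖)
    simpa using h.const_mul (2 * ‖x‖)
  filter_upwards [(tendsto_order.1 hb).2 e he] with n hn z hz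
  rw [dist_eq_norm, norm_sub_rev]
  exact (norm_stripFunE_sub_stripFun_le K (epsSeq_pos n) (epsSeq_le_one n) x ξ η hz).trans_lt hn

include hsep hdense in
/-- **`f` is holomorphic on the open strip `|Re z| < 1/2`.** [cite: RieffelVandaele1977, Lemma 4.7 (proof)] -/
theorem differentiableOn_stripFun (x : H →L[ℂ] H) (ξ η : H) :
    DifferentiableOn ℂ (stripFun K x ξ η) Literature.Analysis.Complex.openStrip := by
  have hsub : Literature.Analysis.Complex.openStrip ⊆ Literature.Analysis.Complex.closedStrip :=
    fun z hz => le_of_lt (α := ℝ) hz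
  refine ((tendstoUniformlyOn_stripFunE K hsep hdense x ξ η).mono hsub).tendstoLocallyUniformlyOn.differentiableOn
    (Eventually.of_forall fun n => ?_) Literature.Analysis.Complex.isOpen_openStrip
  exact (differentiable_stripFunE K (epsSeq_pos n) (epsSeq_le_one n) x ξ η).differentiableOn

/-! ### Boundary values -/

/-- `R^{1/2}` commutes with `Δ^{it}`. [cite: RieffelVandaele1977, Prop. 3.3] -/
theorem sqrtR_commute_modU (t : ℝ) : Commute (sqrtR K) (modU K t) := by
  unfold sqrtR; exact (modR_commute_modU K t).cfc_real _

/-- `(2 − R)^{1/2}` commutes with `Δ^{it}`. [cite: RieffelVandaele1977, Prop. 3.3] -/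
theorem sqrtR'_commute_modU (t : ℝ) : Commute (sqrtR' K) (modU K t) := by
  unfold sqrtR'; exact (modR_commute_modU K t).cfc_real _

/-- `R^{1/2} Δ^{it} R^{1/2} = Δ^{it} R`. [cite: RieffelVandaele1977, Prop. 3.3] -/
theorem sqrtR_modU_sqrtR (t : ℝ) : sqrtR K * modU K t * sqrtR K = modU K t * modR K := by
  rw [(sqrtR_commute_modU K t).eq, mul_assoc, sqrtR_mul_sqrtR]

/-- `(2−R)^{1/2} Δ^{it} (2−R)^{1/2} = Δ^{it} (2 − R)`. [cite: RieffelVandaele1977, Prop. 3.3] -/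
theorem sqrtR'_modU_sqrtR' (t : ℝ) : sqrtR' K * modU K t * sqrtR' K = modU K t * (2 - modR K) := by
  rw [(sqrtR'_commute_modU K t).eq, mul_assoc, sqrtR'_mul_sqrtR']

/-- `Δ^{it} R = R Δ^{it}`. [cite: RieffelVandaele1977, Prop. 3.3] -/
theorem modU_mul_modR (t : ℝ) : modU K t * modR K = modR K * modU K t :=
  (modR_commute_modU K t).eq.symm

/-- `Δ^{it} (2 − R) = (2 − R) Δ^{it}`. [cite: RieffelVandaele1977, Prop. 3.3] -/
theorem modU_mul_two_sub_modR (t : ℝ) : modU K t * (2 - modR K) = (2 - modR K) * modU K t := by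
  rw [mul_sub, sub_mul, modU_mul_modR]
  congr 1
  rw [two_mul, mul_two]

include hsep hdense in
/-- `A(1/2 + it) = (2 − R)^{1/2} Δ^{it} (2 − R)^{1/2}` (vectorwise; an a.e. identity of symbols).
[cite: RieffelVandaele1977, Lemma 4.7 (proof)] -/
theorem modA_half_add_apply (t : ℝ) (ψ : H) :
    modA K ((1 / 2 : ℂ) + t * I) ψ = (modU K t * (2 - modR K)) ψ := by
  have heq : I * ((1 / 2 : ℂ) + t * I) + I / 2 = ((-t : ℝ) : ℂ) + I := by
    push_cast
    linear_combination (t : ℂ) * I_sq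
  have h := borelCFC_kfun_add_I_apply K hsep hdense (-t) ψ
  rw [neg_neg, sqrtR'_modU_sqrtR'] at h
  rw [← h, modA]
  congr 2
  funext l
  rw [afun, heq]

/-- `A(−(1/2 + it)) = R^{1/2} Δ^{−it} R^{1/2} = R Δ^{−it}`. [cite: RieffelVandaele1977, Lemma 4.7 (proof)] -/
theorem modA_neg_half_add (t : ℝ) :
    modA K (-((1 / 2 : ℂ) + t * I)) = modR K * modU K (-t) := by
  have heq : I * (-((1 / 2 : ℂ) + t * I)) + I / 2 = ((t : ℝ) : ℂ) := by
    linear_combination (-(t : ℂ)) * I_sq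
  rw [modA, show afun (-((1 / 2 : ℂ) + t * I)) = kfun (t : ℂ) by funext l; rw [afun, heq],
    borelCFC_kfun_ofReal, sqrtR_modU_sqrtR, modU_mul_modR]

/-- `A(−1/2 + it) = R^{1/2} Δ^{it} R^{1/2} = Δ^{it} R`. [cite: RieffelVandaele1977, Lemma 4.7 (proof)] -/
theorem modA_neg_half_add' (t : ℝ) :
    modA K (-(1 / 2 : ℂ) + t * I) = modU K t * modR K := by
  have heq : I * (-(1 / 2 : ℂ) + t * I) + I / 2 = ((-t : ℝ) : ℂ) := by
    push_cast
    linear_combination (t : ℂ) * I_sq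
  rw [modA, show afun (-(1 / 2 : ℂ) + t * I) = kfun ((-t : ℝ) : ℂ) by funext l; rw [afun, heq],
    borelCFC_kfun_ofReal, neg_neg, sqrtR_modU_sqrtR]

include hsep hdense in
/-- `A(−(−1/2 + it)) = (2−R)^{1/2} Δ^{−it} (2−R)^{1/2} = (2 − R) Δ^{−it}` (vectorwise).
[cite: RieffelVandaele1977, Lemma 4.7 (proof)] -/
theorem modA_neg_neg_half_add_apply (t : ℝ) (ψ : H) :
    modA K (-(-(1 / 2 : ℂ) + t * I)) ψ = ((2 - modR K) * modU K (-t)) ψ := by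
  have heq : I * (-(-(1 / 2 : ℂ) + t * I)) + I / 2 = ((t : ℝ) : ℂ) + I := by
    linear_combination (-(t : ℂ)) * I_sq
  have h := borelCFC_kfun_add_I_apply K hsep hdense t ψ
  rw [sqrtR'_modU_sqrtR', modU_mul_two_sub_modR] at h
  rw [← h, modA]
  congr 2
  funext l
  rw [afun, heq]

/-- The symbol of `T`: `√λ √(2−λ)` (clamped). [cite: RieffelVandaele1977, Def. 2.1 of `T`] -/
theorem modT_eq_borelCFC :
    modT K = borelCFC (modR K) (modR_isSelfAdjoint K)
      (fun l => (Real.sqrt (clamp02 l) : ℂ) * (Real.sqrt (2 - clamp02 l) : ℂ)) := by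
  have hR := modR_isSelfAdjoint K
  have hsm : Measurable fun l => (Real.sqrt (clamp02 l) : ℂ) :=
    Complex.measurable_ofReal.comp continuous_sqrt_clamp02.measurable
  have hsm' : Measurable fun l => (Real.sqrt (2 - clamp02 l) : ℂ) :=
    Complex.measurable_ofReal.comp (Real.continuous_sqrt.comp (continuous_const.sub continuous_clamp02)).measurable
  have hsb : ∀ l, ‖(Real.sqrt (clamp02 l) : ℂ)‖ ≤ Real.sqrt 2 := fun l => by
    rw [Complex.norm_real, Real.norm_eq_abs, abs_of_nonneg (Real.sqrt_nonneg _)]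
    exact Real.sqrt_le_sqrt (clamp02_mem l).2
  have hsb' : ∀ l, ‖(Real.sqrt (2 - clamp02 l) : ℂ)‖ ≤ Real.sqrt 2 := fun l => by
    rw [Complex.norm_real, Real.norm_eq_abs, abs_of_nonneg (Real.sqrt_nonneg _)]
    exact Real.sqrt_le_sqrt (by linarith [(clamp02_mem l).1])
  rw [modT_eq_sqrtR_mul_sqrtR', sqrtR_eq_borelCFC, sqrtR'_eq_borelCFC, ← borelCFC_mul hR hsm hsm' hsb hsb']
  rfl

include hsep hdense in
/-- **`A(0) = T`** (vectorwise: the symbols `λe^{L/2}` and `√(λ(2−λ))` agree on `(0, 2)`).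
[cite: RieffelVandaele1977, Lemma 4.7 (proof)] -/
theorem modA_zero_apply (ψ : H) : modA K 0 ψ = modT K ψ := by
  have hR := modR_isSelfAdjoint K
  have hsm : Measurable fun l => (Real.sqrt (clamp02 l) : ℂ) * (Real.sqrt (2 - clamp02 l) : ℂ) :=
    (Complex.measurable_ofReal.comp continuous_sqrt_clamp02.measurable).mul
      (Complex.measurable_ofReal.comp (Real.continuous_sqrt.comp (continuous_const.sub continuous_clamp02)).measurable)
  have hsb : ∀ l, ‖(Real.sqrt (clamp02 l) : ℂ) * (Real.sqrt (2 - clamp02 l) : ℂ)‖ ≤ Real.sqrt 2 * Real.sqrt 2 :=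
    fun l => by
      rw [norm_mul, Complex.norm_real, Complex.norm_real, Real.norm_eq_abs, Real.norm_eq_abs,
        abs_of_nonneg (Real.sqrt_nonneg _), abs_of_nonneg (Real.sqrt_nonneg _)]
      exact mul_le_mul (Real.sqrt_le_sqrt (clamp02_mem l).2)
        (Real.sqrt_le_sqrt (by linarith [(clamp02_mem l).1])) (Real.sqrt_nonneg _) (Real.sqrt_nonneg _)
  rw [modT_eq_borelCFC, modA]
  refine borelCFC_apply_eq_of_ae_eq hR (measurable_afun 0) hsm (norm_afun_le 0) hsb ψ ?_
  filter_upwards [ae_mem_Ioo K hsep hdense ψ] with l hl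
  have hl' : clamp02 l = l := clamp02_of_mem ⟨hl.1.le, hl.2.le⟩
  rw [afun, mul_zero, zero_add, kfun]
  have him : (I / 2 : ℂ).im = 1 / 2 := by simp
  have hre : (I / 2 : ℂ).re = 0 := by simp
  rw [him, hre, show clamp01 (1 / 2) = 1 / 2 from clamp01_of_mem ⟨by norm_num, by norm_num⟩]
  simp only [ofReal_zero, mul_zero, zero_mul, neg_zero, Complex.exp_zero, mul_one]
  rw [← Complex.ofReal_mul, ← Complex.ofReal_mul, hl']
  congr 1
  -- real identity `l e^{L/2} = √l √(2 − l)` on `(0, 2)`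
  have hL : l * Real.exp (modLog l) = 2 - l := by
    have := clamp02_mul_exp_modLog hl
    rwa [hl'] at this
  have h1 : 0 ≤ l * Real.exp (1 / 2 * modLog l) := by positivity [hl.1.le]
  have h2 : 0 ≤ Real.sqrt l * Real.sqrt (2 - l) := by positivity
  rw [← sq_eq_sq₀ h1 h2]
  have hexp : Real.exp (1 / 2 * modLog l) ^ 2 = Real.exp (modLog l) := by
    rw [sq, ← Real.exp_add]; ring_nf
  rw [mul_pow, mul_pow, Real.sq_sqrt hl.1.le, Real.sq_sqrt (by linarith [hl.2]), hexp, sq, mul_assoc, hL]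

include hsep hdense in
/-- `f(1/2 + it) = ⟪η, Δ^{it}(2 − R) x R Δ^{−it} ξ⟫`. [cite: RieffelVandaele1977, Lemma 4.7 (proof)] -/
theorem stripFun_half_add (x : H →L[ℂ] H) (ξ η : H) (t : ℝ) :
    stripFun K x ξ η ((1 / 2 : ℂ) + t * I) =
      ⟪η, (modU K t * ((2 - modR K) * x * modR K) * modU K (-t)) ξ⟫_ℂ := by
  rw [stripFun, modA_half_add_apply K hsep hdense, modA_neg_half_add]
  simp only [mul_apply_eq_comp]

include hsep hdense in
/-- `f(−1/2 + it) = ⟪η, Δ^{it} R x (2 − R) Δ^{−it} ξ⟫`. [cite: RieffelVandaele1977, Lemma 4.7 (proof)] -/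
theorem stripFun_neg_half_add (x : H →L[ℂ] H) (ξ η : H) (t : ℝ) :
    stripFun K x ξ η (-(1 / 2 : ℂ) + t * I) =
      ⟪η, (modU K t * (modR K * x * (2 - modR K)) * modU K (-t)) ξ⟫_ℂ := by
  rw [stripFun, modA_neg_neg_half_add_apply K hsep hdense, modA_neg_half_add']
  simp only [mul_apply_eq_comp]

include hsep hdense in
/-- `f(0) = ⟪η, T x T ξ⟫`. [cite: RieffelVandaele1977, Lemma 4.7 (proof)] -/
theorem stripFun_zero (x : H →L[ℂ] H) (ξ η : H) : stripFun K x ξ η 0 = ⟪η, modT K (x (modT K ξ))⟫_ℂ := by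
  rw [stripFun, neg_zero, modA_zero_apply K hsep hdense, modA_zero_apply K hsep hdense]

include hsep hdense in
/-- **Rieffel–van Daele's integral identity (the analytic core of Lemma 4.7).** For every bounded
`x`, all `ξ, η` and `|φ| < π`:
`⟪η, T x T ξ⟫ = ∫ W_φ(t) (e^{iφ/2} ⟪η, Δ^{it}(2−R)xRΔ^{−it} ξ⟫ + e^{−iφ/2} ⟪η, Δ^{it}Rx(2−R)Δ^{−it} ξ⟫) dt`,
`W_φ(t) = e^{−φt}/(e^{πt} + e^{−πt})`. [cite: RieffelVandaele1977, Lemmas 4.6, 4.7] -/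
theorem inner_modT_apply_modT_eq_integral (x : H →L[ℂ] H) (ξ η : H) {φ : ℝ} (hφ : |φ| < π) :
    ⟪η, modT K (x (modT K ξ))⟫_ℂ = ∫ t : ℝ, (Literature.Analysis.Complex.weight φ t : ℂ) *
      (Complex.exp (I * (φ / 2)) * ⟪η, (modU K t * ((2 - modR K) * x * modR K) * modU K (-t)) ξ⟫_ℂ +
        Complex.exp (-(I * (φ / 2))) * ⟪η, (modU K t * (modR K * x * (2 - modR K)) * modU K (-t)) ξ⟫_ℂ) := by
  have h := Literature.Analysis.Complex.RieffelVanDaele_strip_formula hφ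
    (continuous_stripFun K x ξ η).continuousOn (differentiableOn_stripFun K hsep hdense x ξ η)
    (fun z _ => norm_stripFun_le K x ξ η z)
  rw [stripFun_zero K hsep hdense] at h
  rw [h]
  congr 1
  funext t
  rw [stripFun_half_add K hsep hdense, stripFun_neg_half_add K hsep hdense]

end Family

end Literature.Analysis.OperatorTheory
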